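import Literature.AlgebraicGeometry.Resolution.BlowupDimension
import Literature.AlgebraicGeometry.Resolution.BlowupsProperProofs
import Literature.AlgebraicGeometry.Resolution.LogResolutionOfClosedSubset
import Literature.AlgebraicGeometry.Resolution.NonPrincipalLocus
import Literature.AlgebraicGeometry.Resolution.BlowupChartMembership
import Literature.AlgebraicGeometry.Resolution.MarkedIdealsLemmas
import Literature.AlgebraicGeometry.Motives.Cycles
import HarnessLib

/-!
# Crux `PatchingRelPerfect` (stmt-ResolutionOfSingularities-16161), chain w52 — programme r-d1,
# piece A1 helpers: BLOWING UP PRESERVES THE DIMENSION; cancelling an effective Cartier divisor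

[OURS · L1 W5.2 · r-d1 A1 helper] Tree plumbing for the typed target
`DepthOneTargets.PrincipalizeControlled` of plan-1's `ChainW52TargetsE.lean` (9d67ec503d849faa),
which asks that the last threefold of the controlled principalizing sequence be again of dimension
THREE and that the end ideal be LOCALLY PRINCIPAL. Theorem-only (no definition, no named fact):

* `DepthOne.exists_ltSeries_of_isClosedMap` — **along a closed continuous map `f : X' → X` of
  schemes every strict chain of specializations `p₀ ≺ ⋯ ≺ pₙ = f x'` lifts to a strict chain of the
  same length ending at `x'`** (descending induction on `closure {f x} = f (closure {x})`, the
  lifting lemma `exists_lt_base_eq_of_isClosedMap` of `Literature/…/Motives/Cycles.lean`; the dual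
  of `height_base_le_of_isClosedMap` there);
* `DepthOne.le_topologicalKrullDim_of_isClosedMap`,
  `DepthOne.topologicalKrullDim_le_of_isClosedMap_of_surjective` — **a closed surjective morphism
  does not lower the dimension: `dim X ≤ dim X'`**;
* `DepthOne.topologicalKrullDim_eq_of_isBlowup` — **`dim X' = dim X` for every blowing up of an
  integral locally Noetherian scheme along a non-zero ideal sheaf** (`≤`:
  `IsBlowup.topologicalKrullDim_le`, Matsumura Thm. 15.5 through the charts; `≥`: the blowing up is
  proper (`IsBlowup.isProper`, Stacks 02NS), hence closed, and the generic point lifts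
  (`IsBlowup.exists_preimage_of_notMem_support`, Stacks 02OS), so every chain lifts);
  `DepthOne.surjective_of_isBlowup` — such a blowing up is surjective;
* `DepthOne.isLocallyPrincipal_of_isEffectiveCartier_mul` — **cancellation**: on a locally
  Noetherian scheme, `P` an effective Cartier divisor and `P · K` locally principal ⟹ `K` locally
  principal (a stalk computation: `t · K_x = (t k)` with `t` a non-zero-divisor forces `K_x = (k)`;
  local principality is a stalk condition, `isLocallyPrincipalAt_iff_isPrincipal_stalkIdeal`).

Nothing here is a statement of the manuscript under review.

## References

* H. Matsumura, *Commutative Ring Theory* (1986), Thm. 15.5. [Matsumura1987]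
* The Stacks Project, Tags 02NS, 02OS, 01WR. [StacksProject]
-/

-- `Summit.<Summit>.<Sub>.Theorems` with `Sub = Summit` (single-conjunct summit, D-0017)
set_option linter.dupNamespace false

noncomputable section

open CategoryTheory CategoryTheory.Limits AlgebraicGeometry TopologicalSpace
open Literature.AlgebraicGeometry.Resolution

namespace Summit.ResolutionOfSingularities.ResolutionOfSingularities.Theorems

universe u

namespace DepthOne

/-! ## Closed maps do not lower the Krull dimension -/

section ClosedMap

variable {X' X : Scheme.{u}} (f : X' ⟶ X)

/-- **Lifting a strict chain of specializations along a closed map.** If `f : X' → X` is closed on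
points and `p` is a strict chain `p₀ < p₁ < ⋯ < pₙ` in the specialization order of `X`
(`a ≤ b ↔ b ⤳ a`) with `pₙ = f x'`, then `X'` has a strict chain of length `n` ending at `x'`
whose head lies over `p₀`: lift `pₙ₋₁ ∈ closure {f x'} = f (closure {x'})` to a specialization
`x'' < x'` of `x'` (strict because the images differ) and recurse. [folklore] -/
theorem exists_ltSeries_of_isClosedMap (hf : IsClosedMap f.base) :
    ∀ (n : ℕ) (p : LTSeries X) (x' : X'), p.length = n → p.last = f.base x' →
      ∃ q : LTSeries X', q.length = n ∧ q.last = x' ∧ f.base q.head = p.head := by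
  intro n
  induction n with
  | zero =>
    intro p x' hlen hlast
    refine ⟨RelSeries.singleton _ x', rfl, RelSeries.last_singleton _, ?_⟩
    rw [RelSeries.head_singleton]
    have h0 : p.head = p.last := by
      change p 0 = p ⟨p.length, _⟩
      congr 1
      ext
      simp [hlen]
    rw [h0, hlast]
  | succ n ih =>
    intro p x' hlen hlast
    have hne : p.length ≠ 0 := by omega
    have hrel0 : p.eraseLast.last < p.last := p.eraseLast_last_rel_last hne
    have hrel : p.eraseLast.last < f.base x' := lt_of_lt_of_eq hrel0 hlast
    obtain ⟨x'', hx''lt, hfx''⟩ :=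
      Literature.AlgebraicGeometry.Motives.exists_lt_base_eq_of_isClosedMap f hf hrel
    obtain ⟨q, hqlen, hqlast, hqhead⟩ := ih p.eraseLast x'' (by simp [hlen]) hfx''.symm
    refine ⟨q.snoc x' (hqlast ▸ hx''lt), by simp [hqlen], RelSeries.last_snoc _ _ _, ?_⟩
    rw [RelSeries.head_snoc, hqhead, RelSeries.head_eraseLast]

/-- **A closed map reaching the top of a chain does not lower dimension**: if `f : X' → X` is
closed and the top `pₙ` of a strict chain of length `n` in `X` specializes from a point of the
image (`pₙ ≤ f x'`), then `n ≤ dim X'`. [folklore] -/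
theorem le_topologicalKrullDim_of_isClosedMap (hf : IsClosedMap f.base) {n : ℕ}
    (p : LTSeries X) (hp : p.length = n) {x' : X'} (hx' : p.last ≤ f.base x') :
    (n : WithBot ℕ∞) ≤ topologicalKrullDim X' := by
  obtain ⟨x'', -, hx''⟩ :=
    Literature.AlgebraicGeometry.Motives.exists_le_base_eq_of_isClosedMap f hf hx'
  obtain ⟨q, hqlen, -, -⟩ := exists_ltSeries_of_isClosedMap f hf n p x'' hp hx''.symm
  rw [topologicalKrullDim_eq_krullDim_carrier]
  exact Order.le_krullDim_iff.mpr ⟨q, hqlen⟩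

/-- **A closed surjective morphism does not lower the dimension**: `dim X ≤ dim X'` for
`f : X' → X` closed and surjective on points (every strict chain of specializations of `X` lifts
to `X'`). [folklore] -/
theorem topologicalKrullDim_le_of_isClosedMap_of_surjective (hf : IsClosedMap f.base)
    (hsurj : Function.Surjective f.base) : topologicalKrullDim X ≤ topologicalKrullDim X' := by
  rw [topologicalKrullDim_eq_krullDim_carrier X, Order.krullDim]
  refine iSup_le fun p => ?_
  obtain ⟨x', hx'⟩ := hsurj p.last
  exact le_topologicalKrullDim_of_isClosedMap f hf p rfl hx'.ge

end ClosedMap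

/-! ## Blowing up preserves the dimension -/

section Blowup

variable {X X' : Scheme.{u}} {π : X' ⟶ X} {C : X.IdealSheafData}

/-- **Blowing up an integral locally Noetherian scheme along a non-zero ideal sheaf preserves the
dimension**: `dim X = n ⟹ dim X' = n`. The inequality `≤` is `IsBlowup.topologicalKrullDim_le`
(Matsumura Thm. 15.5 through the charts); for `≥`, the blowing up is proper
(`IsBlowup.isProper`), hence a closed map, and the generic point of `X` — off the centre since
`C ≠ 0` — has a preimage (`IsBlowup.exists_preimage_of_notMem_support`); every point of `X`
specializes from the generic point, so every strict chain of specializations of `X` lifts to `X'`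
(`le_topologicalKrullDim_of_isClosedMap`). [folklore] -/
theorem topologicalKrullDim_eq_of_isBlowup [IsIntegral X] [IsLocallyNoetherian X]
    (hπ : IsBlowup π C) (hC : C ≠ ⊥) {n : ℕ} (hX : topologicalKrullDim X = n) :
    topologicalKrullDim X' = n := by
  refine le_antisymm (hπ.topologicalKrullDim_le hX.le) ?_
  haveI : IsProper π := hπ.isProper
  obtain ⟨p, hp⟩ : ∃ p : LTSeries X, p.length = n :=
    Order.le_krullDim_iff.mp (by rw [← topologicalKrullDim_eq_krullDim_carrier, hX])
  obtain ⟨ξ', hξ'⟩ := hπ.exists_preimage_of_notMem_support (not_mem_support_genericPoint hC)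
  refine le_topologicalKrullDim_of_isClosedMap π π.isClosedMap p hp (x' := ξ') ?_
  rw [show π.base ξ' = genericPoint X from hξ']
  exact le_top

/-- **Blowing up is surjective** for an integral locally Noetherian scheme and a non-zero centre:
the image is closed (properness) and every point specializes from the generic point, which has a
preimage. [folklore] -/
theorem surjective_of_isBlowup [IsIntegral X] [IsLocallyNoetherian X] (hπ : IsBlowup π C)
    (hC : C ≠ ⊥) : Function.Surjective π.base := by
  haveI : IsProper π := hπ.isProper
  obtain ⟨ξ', hξ'⟩ := hπ.exists_preimage_of_notMem_support (not_mem_support_genericPoint hC)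
  intro x
  obtain ⟨x', -, hx'⟩ := Literature.AlgebraicGeometry.Motives.exists_le_base_eq_of_isClosedMap
    π π.isClosedMap (x := ξ') (y := x)
    (by rw [show π.base ξ' = genericPoint X from hξ']; exact le_top)
  exact ⟨x', hx'⟩

end Blowup

/-! ## Cancelling an effective Cartier divisor from a locally principal product -/

/-- **Cancellation**: on a locally Noetherian scheme, if `P` is an effective Cartier divisor and
`P · K` is locally principal, then `K` is locally principal — on stalks, `P_x = (t)` with `t` a
non-zero-divisor (`IsEffectiveCartier.exists_stalkIdeal_eq_span`) and `t · K_x = (t k)` force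
`K_x = (k)`; local principality is a stalk condition
(`isLocallyPrincipalAt_iff_isPrincipal_stalkIdeal`). [folklore] -/
theorem isLocallyPrincipal_of_isEffectiveCartier_mul {X : Scheme.{u}} [IsLocallyNoetherian X]
    {P K : X.IdealSheafData} (hP : IsEffectiveCartier P) (h : IsLocallyPrincipal (P * K)) :
    IsLocallyPrincipal K := by
  intro x
  apply isLocallyPrincipalAt_of_isPrincipal_stalkIdeal
  obtain ⟨t, ht, hPt⟩ := hP.exists_stalkIdeal_eq_span x
  have hprin := (h x).isPrincipal_stalkIdeal
  rw [stalkIdeal_mul, hPt] at hprin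
  obtain ⟨g, hg⟩ := hprin
  replace hg : Ideal.span {t} * stalkIdeal K x = Ideal.span {g} := hg
  have hgmem : g ∈ Ideal.span {t} * stalkIdeal K x := by
    rw [hg]; exact Ideal.mem_span_singleton_self g
  obtain ⟨k, hk, htk⟩ := Ideal.mem_span_singleton_mul.mp hgmem
  refine ⟨k, le_antisymm ?_ ?_⟩
  · intro c hc
    have hmem : t * c ∈ Ideal.span {t} * stalkIdeal K x :=
      Ideal.mul_mem_mul (Ideal.mem_span_singleton_self t) hc
    rw [hg, ← htk] at hmem
    obtain ⟨d, hd⟩ := Ideal.mem_span_singleton'.mp hmem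
    -- `d * (t * k) = t * c`: cancel the non-zero-divisor `t`
    have h0 : (c - d * k) * t = 0 := by
      rw [sub_mul, mul_comm c t, ← hd]; ring
    have hc' : c - d * k = 0 := (mem_nonZeroDivisors_iff_right.mp ht) _ h0
    rw [sub_eq_zero] at hc'
    rw [hc']
    exact Ideal.mul_mem_left _ d (Ideal.mem_span_singleton_self k)
  · change Ideal.span {k} ≤ stalkIdeal K x
    rw [Ideal.span_singleton_le_iff_mem]
    exact hk

end DepthOne

end Summit.ResolutionOfSingularities.ResolutionOfSingularities.Theorems

end
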